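import Summits.QuantumFields.YangMills.Theorems.BalabanUVNodesN22KernelFadingOfStepRateModel

/-!
# BalabanUVNodes ∕ node N22 = NE9 — THE QUADRATIC TWO-BOND MODEL OF THE KERNEL-FADING ROAD (module J38 §1, «ROAD 2»), PART 2: NON-DEGENERACY —
# nonzero kernels, sensitivity to the OLDEST coupling at every age with a LOWER BOUND on any NE9 modulus, nonzero second differences;
# every constant J38 reads at this inhabitant is FORCED positive (referee standard A6, MODEL LEVEL)

Cell `pub-ymgap`, HUMAN RULING D-0062 (Track A), WIDTH SEAT `pub-ymgap-dag-n22-w2` (g5; A6-residue FLAG №3 lane of node N22).  THEOREMS ONLY (no `def`, no `sorry`,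
standard axioms); `--kind proof --supports stmt-QuantumFields-27366 --as helper` (K3⁸ `SpineGivenEndpointR13SepCoPHV`, dag-lead KEY MAP v2), COUNT-NEUTRAL.
Imports PART 1 `…Theorems.BalabanUVNodesN22KernelFadingOfStepRateModel` (the two-bond family with the quadratic fading amplitude `a k v = Σ_{i ≤ k} ω^{k+1−i} v_i²∕2`
through def-B's (1.20)–(1.22) machinery; node N18's letter, (1.18), (R₂) with explicit constants; J38's knit fires) and through it dag-n22-c's J38 and dag-n18-w2's model
files BY NAME.  Nothing re-declared.

WHY.  PART 1 showed that module J38's generic antecedent {(N18) `KernelStepRate`, (1.18) `DecayBound`, (R₂) uniform second differences} is met by ONE scalar term family and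
that J38's ★★★ `ne9_and_fadingMemory_EA_of_kernelStepRate_secondDiff` fires on it.  An A6 certificate must also rule out the degenerate readings that made the OLD junction
vacuous (module J37: `B₃ = 0 ∨ E₀ ≤ 0`; the smoke tests of this lineage fired at ZERO kernels).  THIS FILE: (a) the mixed kernel entry at the support point is the
amplitude, `Π₀₁(g; e) = a k (g_0,…,g_k)`, POSITIVE on the window — the kernels are NONZERO; (b) changing ONLY the oldest coupling moves the level-`(k+1)` kernel by
`ω^{k+1}(s² − g_0²)∕2` — the functional is HISTORY-SENSITIVE AT EVERY AGE, and quantitatively ANY NE9 bound `NE9 (EA …) (Window γ) κ Λ` for it has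
`(3γ∕4)·ω^{k+1}·e^{κ|e|₁} ≤ Λ (k+1) 0`: the memory of the oldest coupling does NOT fade faster than `ω^{k+1}` (J38 produces `C₉ τ^{k+1}` with `τ ≥ √ω > ω` — consistent, and
the produced fading memory is ACTIVE, not idle); (c) the kernel second difference in coupling `i` is EXACTLY `crossKernel (ω^{k+1−i} d²) e`, NONZERO — the (R₂) slot is NOT
met with `M = 0`, so ROAD 2's second-order input is genuinely used at this inhabitant; (d) node N18's letter with constant `0` and (1.18) with constant `0` both FAIL;
(e) every constant J38 reads (`C₅`, `E₀`, `M`) and produces (`C₉`) is POSITIVE.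
* `kernelA_quadCross_zero_one_self` · ★ `kernelA_quadCross_pos` · `kernelA_quadCross_update_oldest_sub` · ★ `kernelA_quadCross_oldest_ne` ·
  ★★ `ne9_modulus_oldest_lower_bound` · `quadAmp_lipschitz` · ★ `ne9_EA_quadCross_trueRate` (the TRUE rate is `ω`; ROAD 2's `√ω` brackets it) · `kernelSecondDiff_quadCross_eq` · ★ `not_kernelSecondDiff_quadCross_zero` · ★ `not_kernelStepRate_quadCross_zero` ·
  ★ `not_decayBound_quadCross_zero` · `constants_quadCross_pos`; §5 (the producer-side junction, module J38 §3, at the model): `windowedSecondDiff_quadCross_eventually_eq` (the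
  WINDOWED second difference is EXACTLY `crossKernel (ω^{k+1−i} d²) e` eventually in `K`) · ★ `windowedSecondDiff_quadCross` (J38 §3's `hlim ∧ hW2` at the model).

HONEST FRAMING (binding).  MODEL LEVEL: a scalar two-bond test functional with a quadratic fading amplitude — NOT Bałaban's merged term (1.6) ∕ (2.13); it inhabits NO
letter OF RECORD; it certifies ONLY that ROAD 2's generic antecedent is jointly satisfiable NON-DEGENERATELY through def-B's (1.20)–(1.22) definitions.  Nothing of
Bałaban's is proved or asserted; NE5 ∕ NE9 are NOT PRINTED for d = 4; N22 ∕ N18 ∕ (D4) NOT discharged (typed 28∕28 · discharged 5∕27 UNMOVED — the chair's single count line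
is the only count); K3⁸ OPEN and NOT claimed; one finite 𝕋⁴ programme at fixed ε — R4 closes the CONDITIONAL rung `BalabanLadder.UV` only; NOTHING about the continuum
limit, ℝ⁴, infinite volume, OS axioms, a mass gap or the Clay problem is proved or claimed.  References (TYPES only): [I] = Bałaban, CMP 109 (1987) Thm 1 p. 259, (1.18)
p. 263, (1.20)–(1.22) p. 264, (5.10) p. 293, §5 p. 298; [II] = CMP 116 (1988) (2.13)–(2.14) pp. 14–15.
-/

noncomputable section

open Filter Topology Set
open scoped BigOperators

namespace YMDAG.N22.KernelFading.Model

open Literature.MathematicalPhysics.QuantumFieldTheory.Balaban1983to89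
open Literature.MathematicalPhysics.QuantumFieldTheory.Balaban1983to89.T4Continuum (T4Family)
open Literature.MathematicalPhysics.QuantumFieldTheory.Balaban1983to89.T4OutputRate (Window NE9 FadingMemory DecayBound)
open Literature.MathematicalPhysics.QuantumFieldTheory.Balaban1983to89.FlowStep (Box HBeta mem_box)
open Literature.MathematicalPhysics.QuantumFieldTheory.Balaban1983to89.Node00 (TermFamily1 Stage13Params U3Letters₁₁ prependCoupling polWindow)
open Literature.MathematicalPhysics.QuantumFieldTheory.Balaban1983to89.Node00.U3OfKernels (carriers histPrefix histPrefix_apply kernelA EA EA_apply objects ne9_EA_iff)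
open Literature.MathematicalPhysics.QuantumFieldTheory.Balaban1983to89.Node00.U3KernelLetters (KernelStepRate)
open Literature.MathematicalPhysics.QuantumFieldTheory.Balaban1983to89.B12Sec2to5 (l1 Decay510)
open YMDAG.N18.FiniteVolumeLettersModel (fadingAmp fadingAmp_succ fadingAmp_zero abs_fadingAmp_le fadingAmp_pos histPrefix_mem_box)
open YMDAG.N18.RunningBetaLettersModel (crossKernel crossKernel_zero_one crossKernel_sub abs_crossKernel_le wt wt_nonneg crossTermFamily kernelA_crossTermFamily
  kernelStepRate_cross polWindow_crossTermFamily_eventually polLimitsExist_cross)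

/-! ## §4 NON-DEGENERACY of the quadratic two-bond inhabitant -/

section NonDegenerate

variable (F : T4Family)

/-- **THE MIXED ENTRY AT THE SUPPORT POINT IS THE AMPLITUDE**: `Π₀₁(g; e) = a k (g_0,…,g_k)`. [folklore] -/
theorem kernelA_quadCross_zero_one_self (ω : ℝ) (e : Fin 4 → ℤ) (g : ℕ → ℝ) (k : ℕ) :
    kernelA F (crossTermFamily F (fun k v => fadingAmp ω k (fun j => v j ^ 2 / 2)) e) (ContinuousLinearMap.id ℝ ℝ) (Module.Basis.singleton Unit ℝ) g k 0 1 e =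
      fadingAmp ω k (fun j => histPrefix g k j ^ 2 / 2) := by
  rw [kernelA_crossTermFamily, crossKernel_zero_one, if_pos rfl]

/-- ★ **THE KERNELS ARE NONZERO**: `0 < Π₀₁(g; e)` for every window history `g` and level `k` (`0 < ω`) — the model is NOT the zero functional of the smoke tests. [folklore] -/
theorem kernelA_quadCross_pos {ω γ : ℝ} (hω : 0 < ω) (e : Fin 4 → ℤ) {g : ℕ → ℝ} (hg : g ∈ Window γ) (k : ℕ) :
    0 < kernelA F (crossTermFamily F (fun k v => fadingAmp ω k (fun j => v j ^ 2 / 2)) e) (ContinuousLinearMap.id ℝ ℝ) (Module.Basis.singleton Unit ℝ) g k 0 1 e := by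
  rw [kernelA_quadCross_zero_one_self]
  exact quadAmp_pos hω (histPrefix_mem_box hg k)

/-- **CHANGING ONLY THE OLDEST COUPLING MOVES THE LEVEL-`(k+1)` KERNEL BY `ω^{k+1}(s² − g_0²)∕2`** — the memory of age `k + 1` is read with weight EXACTLY `ω^{k+1}`. [folklore] -/
theorem kernelA_quadCross_update_oldest_sub (ω : ℝ) (e : Fin 4 → ℤ) (g : ℕ → ℝ) (k : ℕ) (s : ℝ) :
    kernelA F (crossTermFamily F (fun k v => fadingAmp ω k (fun j => v j ^ 2 / 2)) e) (ContinuousLinearMap.id ℝ ℝ) (Module.Basis.singleton Unit ℝ)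
        (Function.update g 0 s) k 0 1 e -
      kernelA F (crossTermFamily F (fun k v => fadingAmp ω k (fun j => v j ^ 2 / 2)) e) (ContinuousLinearMap.id ℝ ℝ) (Module.Basis.singleton Unit ℝ) g k 0 1 e =
      ω ^ (k + 1) * (s ^ 2 / 2 - g 0 ^ 2 / 2) := by
  rw [kernelA_quadCross_zero_one_self, kernelA_quadCross_zero_one_self, quadAmp_histPrefix_update ω g k (Nat.zero_lt_succ k), Nat.sub_zero]
  ring

/-- ★ **HISTORY-SENSITIVE AT EVERY AGE**: two POSITIVE values of the oldest coupling that differ give DIFFERENT level-`(k+1)` kernels, for every `k` (`0 < ω`) — so in ANY NE9 bound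
for this functional the modulus `Λ (k+1) 0` of the oldest coupling cannot vanish: the fading memory J38 produces is active, not idle. [folklore] -/
theorem kernelA_quadCross_oldest_ne {ω : ℝ} (hω : 0 < ω) (e : Fin 4 → ℤ) {g : ℕ → ℝ} {s : ℝ} (hg0 : 0 < g 0) (hs : 0 < s) (hne : s ≠ g 0) (k : ℕ) :
    kernelA F (crossTermFamily F (fun k v => fadingAmp ω k (fun j => v j ^ 2 / 2)) e) (ContinuousLinearMap.id ℝ ℝ) (Module.Basis.singleton Unit ℝ)
        (Function.update g 0 s) k 0 1 e ≠
      kernelA F (crossTermFamily F (fun k v => fadingAmp ω k (fun j => v j ^ 2 / 2)) e) (ContinuousLinearMap.id ℝ ℝ) (Module.Basis.singleton Unit ℝ) g k 0 1 e := by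
  intro h
  have hsub := kernelA_quadCross_update_oldest_sub F ω e g k s
  rw [h, sub_self] at hsub
  have hωk : ω ^ (k + 1) ≠ 0 := pow_ne_zero _ hω.ne'
  have hsq : s ^ 2 / 2 - g 0 ^ 2 / 2 = 0 := by
    rcases mul_eq_zero.1 hsub.symm with h1 | h1
    · exact absurd h1 hωk
    · exact h1
  have hsg : s ^ 2 = g 0 ^ 2 := by linarith
  have := (sq_eq_sq₀ hs.le hg0.le).1 hsg
  exact hne this

/-- ★★ **A LOWER BOUND ON ANY NE9 MODULUS OF THE OLDEST COUPLING**: if `NE9 (EA …) (Window γ) κ Λ` holds for the quadratic two-bond functional, then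
`(3γ∕4)·ω^{k+1}·e^{κ|e|₁} ≤ Λ (k+1) 0` for EVERY level `k` (`0 < ω`, `0 < γ`; witnesses: the constant history `γ` and its update `g_0 := γ∕2`, the mixed entry at `z = e`) — the
memory of age `k + 1` does NOT fade faster than `ω^{k+1}`: the fading memory module J38 produces for this inhabitant is ACTIVE at every age, never idle. [folklore] -/
theorem ne9_modulus_oldest_lower_bound {ω γ : ℝ} (hω : 0 < ω) (hγ : 0 < γ) (e : Fin 4 → ℤ) (κ : ℝ) {Λ : ℕ → ℕ → ℝ}
    (h : NE9 (EA F (crossTermFamily F (fun k v => fadingAmp ω k (fun j => v j ^ 2 / 2)) e) (ContinuousLinearMap.id ℝ ℝ) (Module.Basis.singleton Unit ℝ)) (Window γ) κ Λ)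
    (k : ℕ) : 3 * γ / 4 * ω ^ (k + 1) * Real.exp (κ * l1 e) ≤ Λ (k + 1) 0 := by
  have hg : (fun _ : ℕ => γ) ∈ Window γ := fun _ => ⟨hγ, le_rfl⟩
  have hg' : Function.update (fun _ : ℕ => γ) 0 (γ / 2) ∈ Window γ := by
    intro i
    by_cases hi : i = 0
    · subst hi; rw [Function.update_self]; exact ⟨by linarith, by linarith⟩
    · rw [Function.update_of_ne hi]; exact ⟨hγ, le_rfl⟩
  have hk := (ne9_EA_iff F _ _ _ (Window γ) κ Λ).1 h _ hg' _ hg k 0 1 e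
  rw [kernelA_quadCross_update_oldest_sub] at hk
  have hsum : ∑ i ∈ Finset.range (k + 1), Λ (k + 1) i * |Function.update (fun _ : ℕ => γ) 0 (γ / 2) i - (fun _ : ℕ => γ) i| = Λ (k + 1) 0 * (γ / 2) := by
    rw [Finset.sum_eq_single 0]
    · rw [Function.update_self]
      show Λ (k + 1) 0 * |γ / 2 - γ| = Λ (k + 1) 0 * (γ / 2)
      rw [show γ / 2 - γ = -(γ / 2) by ring, abs_neg, abs_of_pos (by linarith)]
    · intro i _ hi
      rw [Function.update_of_ne hi, sub_self, abs_zero, mul_zero]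
    · intro h0
      exact absurd (Finset.mem_range.2 (Nat.succ_pos k)) h0
  rw [hsum] at hk
  have hval : |ω ^ (k + 1) * ((γ / 2) ^ 2 / 2 - γ ^ 2 / 2)| = ω ^ (k + 1) * (3 * γ ^ 2 / 8) := by
    rw [show (γ / 2) ^ 2 / 2 - γ ^ 2 / 2 = -(3 * γ ^ 2 / 8) by ring, mul_neg, abs_neg, abs_of_nonneg (by positivity)]
  rw [hval] at hk
  have hexp : 0 < Real.exp (κ * l1 e) := Real.exp_pos _
  have hprod : Real.exp (κ * l1 e) * Real.exp (-(κ * l1 e)) = 1 := by rw [← Real.exp_add, add_neg_cancel, Real.exp_zero]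
  -- multiply the NE9 inequality by `e^{κ|e|₁}` and divide by `γ ∕ 2`
  have h2 : ω ^ (k + 1) * (3 * γ ^ 2 / 8) * Real.exp (κ * l1 e) ≤ Λ (k + 1) 0 * (γ / 2) := by
    have := mul_le_mul_of_nonneg_right hk hexp.le
    calc ω ^ (k + 1) * (3 * γ ^ 2 / 8) * Real.exp (κ * l1 e)
        ≤ Real.exp (-(κ * l1 e)) * (Λ (k + 1) 0 * (γ / 2)) * Real.exp (κ * l1 e) := this
      _ = Λ (k + 1) 0 * (γ / 2) * (Real.exp (κ * l1 e) * Real.exp (-(κ * l1 e))) := by ring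
      _ = Λ (k + 1) 0 * (γ / 2) := by rw [hprod, mul_one]
  nlinarith [h2, hγ, pow_pos hω (k + 1), hexp]

/-- **THE QUADRATIC AMPLITUDE IS HISTORY-LIPSCHITZ WITH MODULI `γ·ω^{k+1−i}` ALONG THE WINDOW** (`|v² − v′²|∕2 ≤ γ|v − v′|` on `]0, γ]`). [folklore] -/
theorem quadAmp_lipschitz {ω : ℝ} (hω : 0 ≤ ω) (γ : ℝ) :
    ∀ g ∈ Window γ, ∀ g' ∈ Window γ, ∀ k,
      |(fun (k : ℕ) (v : Fin (k + 1) → ℝ) => fadingAmp ω k (fun j => v j ^ 2 / 2)) k (histPrefix g k) -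
          (fun (k : ℕ) (v : Fin (k + 1) → ℝ) => fadingAmp ω k (fun j => v j ^ 2 / 2)) k (histPrefix g' k)| ≤
        ∑ i ∈ Finset.range (k + 1), γ * ω ^ (k + 1 - i) * |g i - g' i| := by
  intro g hg g' hg' k
  show |fadingAmp ω k (fun j => histPrefix g k j ^ 2 / 2) - fadingAmp ω k (fun j => histPrefix g' k j ^ 2 / 2)| ≤ _
  rw [YMDAG.N18.FiniteVolumeLettersModel.fadingAmp_sub, ← Fin.sum_univ_eq_sum_range (fun i => γ * ω ^ (k + 1 - i) * |g i - g' i|) (k + 1)]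
  refine (Finset.abs_sum_le_sum_abs _ _).trans (Finset.sum_le_sum fun j _ => ?_)
  simp only [histPrefix_apply]
  have h1 := hg j
  have h2 := hg' j
  have hq : |g j ^ 2 / 2 - g' j ^ 2 / 2| ≤ γ * |g j - g' j| := by
    rw [show g j ^ 2 / 2 - g' j ^ 2 / 2 = (g j + g' j) / 2 * (g j - g' j) by ring, abs_mul]
    refine mul_le_mul_of_nonneg_right ?_ (abs_nonneg _)
    rw [abs_of_pos (by linarith [h1.1, h2.1])]
    linarith [h1.2, h2.2]
  rw [abs_mul, abs_of_nonneg (pow_nonneg hω _)]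
  calc ω ^ (k + 1 - (j : ℕ)) * |g j ^ 2 / 2 - g' j ^ 2 / 2| ≤ ω ^ (k + 1 - (j : ℕ)) * (γ * |g j - g' j|) :=
        mul_le_mul_of_nonneg_left hq (pow_nonneg hω _)
    _ = γ * ω ^ (k + 1 - (j : ℕ)) * |g j - g' j| := by ring

/-- ★ **THE TRUE RATE IS `ω`**: DIRECTLY (dag-n18-w2's `ne9_EA_cross` on the Lipschitz law) the quadratic two-bond functional has `NE9 (EA …) (Window γ) κ (wt κ e·γ·ω^{k−i})`;
with `ne9_modulus_oldest_lower_bound` the oldest modulus is PINNED between `(3γ∕4)e^{κ|e|₁}·ω^{k+1}` and `γ·wt κ e·ω^{k+1}` — memory fades at rate EXACTLY `ω`, while ROAD 2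
(PART 1's `ne9_and_fadingMemory_quadCross`) delivers rates `τ` with `ω ≤ τϱ`, e.g. `√ω ≥ ω`: the road's exponent brackets the true one from above (dag-n22-w1's
`…KnitRoadRatesSharp`: `θ₅ ≤ ω²` is necessary on the second-difference road).  MODEL LEVEL. [folklore] -/
theorem ne9_EA_quadCross_trueRate {ω : ℝ} (hω : 0 ≤ ω) (γ : ℝ) (e : Fin 4 → ℤ) (κ : ℝ) :
    NE9 (EA F (crossTermFamily F (fun k v => fadingAmp ω k (fun j => v j ^ 2 / 2)) e) (ContinuousLinearMap.id ℝ ℝ) (Module.Basis.singleton Unit ℝ)) (Window γ) κ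
      (fun n i => wt κ e * (γ * ω ^ (n - i))) :=
  YMDAG.N18.RunningBetaLettersModel.ne9_EA_cross (Λ := fun n i => γ * ω ^ (n - i)) F (quadAmp_lipschitz hω γ) e κ

/-- **THE KERNEL SECOND DIFFERENCE IN CLOSED FORM**: in coupling `i ≤ k`, step `d`, it is EXACTLY `crossKernel (ω^{k+1−i} d²) e`. [folklore] -/
theorem kernelSecondDiff_quadCross_eq (ω : ℝ) (e : Fin 4 → ℤ) (g : ℕ → ℝ) (k : ℕ) (μ ν : Fin 4) (z : Fin 4 → ℤ) {i : ℕ} (hi : i < k + 1) (t d : ℝ) :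
    kernelA F (crossTermFamily F (fun k v => fadingAmp ω k (fun j => v j ^ 2 / 2)) e) (ContinuousLinearMap.id ℝ ℝ) (Module.Basis.singleton Unit ℝ)
          (Function.update g i (t + d)) k μ ν z -
        2 * kernelA F (crossTermFamily F (fun k v => fadingAmp ω k (fun j => v j ^ 2 / 2)) e) (ContinuousLinearMap.id ℝ ℝ) (Module.Basis.singleton Unit ℝ)
          (Function.update g i t) k μ ν z +
        kernelA F (crossTermFamily F (fun k v => fadingAmp ω k (fun j => v j ^ 2 / 2)) e) (ContinuousLinearMap.id ℝ ℝ) (Module.Basis.singleton Unit ℝ)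
          (Function.update g i (t - d)) k μ ν z =
      crossKernel (ω ^ (k + 1 - i) * d ^ 2) e μ ν z := by
  rw [kernelA_crossTermFamily, kernelA_crossTermFamily, kernelA_crossTermFamily, crossKernel_secondDiff]
  exact congrArg (fun c => crossKernel c e μ ν z) (quadAmp_secondDiff ω g k hi t d)

/-- ★ **THE (R₂) SLOT IS NOT IDLE**: the second differences of the model's kernels are NONZERO — the mixed entry at `z = e` has second difference `ω^{k+1−i} d² > 0` — so J38's
second-difference input CANNOT be met with `M = 0` at this inhabitant (`0 < ω`, `0 < γ`; witness: level `0`, coupling `0`, `t = d = γ∕2`). [folklore] -/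
theorem not_kernelSecondDiff_quadCross_zero {ω γ : ℝ} (hω : 0 < ω) (hγ : 0 < γ) (e : Fin 4 → ℤ) (κ : ℝ) :
    ¬ (∀ g ∈ Window γ, ∀ (k : ℕ) (μ ν : Fin 4) (z : Fin 4 → ℤ) (i : ℕ), i < k + 1 → ∀ t d : ℝ, 0 < d →
      t - d ∈ Ioc (0 : ℝ) γ → t + d ∈ Ioc (0 : ℝ) γ →
        |kernelA F (crossTermFamily F (fun k v => fadingAmp ω k (fun j => v j ^ 2 / 2)) e) (ContinuousLinearMap.id ℝ ℝ) (Module.Basis.singleton Unit ℝ)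
              (Function.update g i (t + d)) k μ ν z -
            2 * kernelA F (crossTermFamily F (fun k v => fadingAmp ω k (fun j => v j ^ 2 / 2)) e) (ContinuousLinearMap.id ℝ ℝ) (Module.Basis.singleton Unit ℝ)
              (Function.update g i t) k μ ν z +
            kernelA F (crossTermFamily F (fun k v => fadingAmp ω k (fun j => v j ^ 2 / 2)) e) (ContinuousLinearMap.id ℝ ℝ) (Module.Basis.singleton Unit ℝ)
              (Function.update g i (t - d)) k μ ν z| ≤
          0 * Real.exp (-(κ * l1 z)) * d ^ 2) := by
  intro h
  have hg : (fun _ : ℕ => γ) ∈ Window γ := fun _ => ⟨hγ, le_rfl⟩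
  have hm : γ / 2 - γ / 4 ∈ Ioc (0 : ℝ) γ := ⟨by linarith, by linarith⟩
  have hp : γ / 2 + γ / 4 ∈ Ioc (0 : ℝ) γ := ⟨by linarith, by linarith⟩
  have h0 := h _ hg 0 0 1 e 0 (Nat.zero_lt_succ 0) (γ / 2) (γ / 4) (by linarith) hm hp
  rw [kernelSecondDiff_quadCross_eq F ω e _ 0 0 1 e (Nat.zero_lt_succ 0), crossKernel_zero_one, if_pos rfl, zero_mul, zero_mul] at h0
  have hpos : 0 < ω ^ (0 + 1 - 0) * (γ / 4) ^ 2 := by positivity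
  have := abs_nonpos_iff.1 h0
  linarith [this]

/-- ★ **NODE N18's LETTER CANNOT HOLD WITH CONSTANT `0`** at this inhabitant: prepending `b` moves the level kernel by `ω^{k+2} b²∕2 ≠ 0` (`0 < ω`, `0 < γ`). [folklore] -/
theorem not_kernelStepRate_quadCross_zero {ω γ : ℝ} (hω : 0 < ω) (hγ : 0 < γ) (e : Fin 4 → ℤ) (κ θ : ℝ) :
    ¬ KernelStepRate F (crossTermFamily F (fun k v => fadingAmp ω k (fun j => v j ^ 2 / 2)) e) (ContinuousLinearMap.id ℝ ℝ) (Module.Basis.singleton Unit ℝ) γ κ θ 0 := by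
  intro h
  have hg : (fun _ : ℕ => γ) ∈ Window γ := fun _ => ⟨hγ, le_rfl⟩
  have h0 := h γ hγ le_rfl _ hg 0 0 1 e
  rw [zero_mul, zero_mul, kernelA_quadCross_zero_one_self, kernelA_quadCross_zero_one_self] at h0
  have hsub : fadingAmp ω (0 + 1) (fun j => histPrefix (prependCoupling γ fun _ => γ) (0 + 1) j ^ 2 / 2) -
      fadingAmp ω 0 (fun j => histPrefix (fun _ : ℕ => γ) 0 j ^ 2 / 2) = ω ^ (0 + 2) * (γ ^ 2 / 2) := by
    have hq := quadAmp_twoRun_eq ω 0 (histPrefix (prependCoupling γ fun _ => γ) (0 + 1))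
    have htail : (fun j : Fin (0 + 1) => Fin.tail (histPrefix (prependCoupling γ fun _ => γ) (0 + 1)) j ^ 2 / 2) =
        fun j => histPrefix (fun _ : ℕ => γ) 0 j ^ 2 / 2 := by
      funext j; simp [Fin.tail, histPrefix, Node00.prependCoupling_succ]
    rw [htail] at hq
    rw [hq]
    simp [histPrefix, Node00.prependCoupling_zero]
  have hpos : 0 < ω ^ (0 + 2) * (γ ^ 2 / 2) := by positivity
  have habs := abs_nonpos_iff.1 h0
  rw [← neg_sub, neg_eq_zero] at habs
  linarith [habs ▸ hsub]

/-- ★ **(1.18) CANNOT HOLD WITH CONSTANT `0`** at this inhabitant: the kernels are nonzero (`0 < ω`, `0 < γ`). [folklore] -/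
theorem not_decayBound_quadCross_zero {ω γ : ℝ} (hω : 0 < ω) (hγ : 0 < γ) (e : Fin 4 → ℤ) (κ : ℝ) :
    ¬ DecayBound (EA F (crossTermFamily F (fun k v => fadingAmp ω k (fun j => v j ^ 2 / 2)) e) (ContinuousLinearMap.id ℝ ℝ) (Module.Basis.singleton Unit ℝ))
        (Window γ) 0 κ := by
  intro h
  have hg : (fun _ : ℕ => γ) ∈ Window γ := fun _ => ⟨hγ, le_rfl⟩
  have h0 := h _ hg PUnit.unit ((0 : ℕ), (0 : Fin 4), (1 : Fin 4), e)
  rw [EA_apply, zero_mul] at h0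
  have hpos := kernelA_quadCross_pos F hω e hg 0
  have := abs_nonpos_iff.1 h0
  exact absurd this hpos.ne'

/-- **EVERY CONSTANT J38 READS AT THIS INHABITANT IS POSITIVE**: `0 < C₅`, `0 < E₀`, `0 < M`, and the produced `0 < C₉` (`0 < ω < 1`, `0 < γ`, `0 < τ`). [folklore] -/
theorem constants_quadCross_pos {γ ω τ : ℝ} (hγ : 0 < γ) (hω : 0 < ω) (hω1 : ω < 1) (hτ : 0 < τ) (e : Fin 4 → ℤ) (κ : ℝ) :
    0 < γ ^ 2 * ω / 2 * wt κ e ∧ 0 < γ ^ 2 / 2 * (ω / (1 - ω)) * wt κ e ∧ 0 < ω * wt κ e ∧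
      0 < (4 * (2 * (γ ^ 2 * ω / 2 * wt κ e) / (1 - ω) + 2 * (γ ^ 2 / 2 * (ω / (1 - ω)) * wt κ e)) / γ + ω * wt κ e * γ / 2) / τ := by
  have hw := wt_pos κ e
  have h1 : 0 < 1 - ω := by linarith
  exact ⟨by positivity, by positivity, by positivity, by positivity⟩

end NonDegenerate

/-! ## §5 The PRODUCER-SIDE junction (module J38 §3) at the model: the WINDOWED second-difference letter `hW2` holds — exactly — at finite volume, eventually in `K` -/

section Windowed

variable (F : T4Family)

/-- **THE WINDOWED SECOND DIFFERENCE IN CLOSED FORM, EVENTUALLY IN THE VOLUME**: for the quadratic two-bond family, def-B's FINITE-VOLUME windowed kernels have second difference in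
coupling `i ≤ k` EXACTLY `crossKernel (ω^{k+1−i} d²) e` once the torus window separates `z`, `e`, `0` (dag-n18-w2's `polWindow_crossTermFamily_eventually` at the three updated
histories).  MODEL LEVEL. [folklore] -/
theorem windowedSecondDiff_quadCross_eventually_eq (ω : ℝ) (e : Fin 4 → ℤ) (g : ℕ → ℝ) (k : ℕ) (μ ν : Fin 4) (z : Fin 4 → ℤ) {i : ℕ} (hi : i < k + 1)
    (t d : ℝ) :
    ∀ᶠ K in atTop,
      polWindow F K (k + 1) (crossTermFamily F (fun k v => fadingAmp ω k (fun j => v j ^ 2 / 2)) e k (histPrefix (Function.update g i (t + d)) k) K)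
          (ContinuousLinearMap.id ℝ ℝ) (Module.Basis.singleton Unit ℝ) μ ν z -
        2 * polWindow F K (k + 1) (crossTermFamily F (fun k v => fadingAmp ω k (fun j => v j ^ 2 / 2)) e k (histPrefix (Function.update g i t) k) K)
          (ContinuousLinearMap.id ℝ ℝ) (Module.Basis.singleton Unit ℝ) μ ν z +
        polWindow F K (k + 1) (crossTermFamily F (fun k v => fadingAmp ω k (fun j => v j ^ 2 / 2)) e k (histPrefix (Function.update g i (t - d)) k) K)
          (ContinuousLinearMap.id ℝ ℝ) (Module.Basis.singleton Unit ℝ) μ ν z =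
      crossKernel (ω ^ (k + 1 - i) * d ^ 2) e μ ν z := by
  filter_upwards [polWindow_crossTermFamily_eventually F (fun k v => fadingAmp ω k (fun j => v j ^ 2 / 2)) e k (histPrefix (Function.update g i (t + d)) k) μ ν z,
    polWindow_crossTermFamily_eventually F (fun k v => fadingAmp ω k (fun j => v j ^ 2 / 2)) e k (histPrefix (Function.update g i t) k) μ ν z,
    polWindow_crossTermFamily_eventually F (fun k v => fadingAmp ω k (fun j => v j ^ 2 / 2)) e k (histPrefix (Function.update g i (t - d)) k) μ ν z] with K h1 h2 h3
  rw [h1, h2, h3, crossKernel_secondDiff]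
  exact congrArg (fun c => crossKernel c e μ ν z) (quadAmp_secondDiff ω g k hi t d)

/-- ★ **MODULE J38 §3's DISPLAYED INPUT `hW2` HOLDS AT THE MODEL** (windowed second differences `≤ (ω·wt κ e)·e^{−κ|z|₁}·d²` eventually in `K`, in every young coupling, `0 ≤ ω ≤ 1`),
together with its `hlim` (dag-n18-w2's `polLimitsExist_cross`): so `kernelSecondDiff_of_windowed` FIRES here and returns PART 1's (R₂) letter `kernelSecondDiff_quadCross` by the
(1.21) passage — the producer-side junction of ROAD 2 is inhabited by the same non-degenerate object.  MODEL LEVEL. [folklore] -/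
theorem windowedSecondDiff_quadCross {ω : ℝ} (hω : 0 ≤ ω) (hω1 : ω ≤ 1) (γ : ℝ) (e : Fin 4 → ℤ) (κ : ℝ) :
    (∀ g ∈ Window γ, ∀ k : ℕ, Node00.PolLimitExists F (k + 1)
      (fun K => crossTermFamily F (fun k v => fadingAmp ω k (fun j => v j ^ 2 / 2)) e k (histPrefix g k) K) (ContinuousLinearMap.id ℝ ℝ) (Module.Basis.singleton Unit ℝ)) ∧
    ∀ g ∈ Window γ, ∀ (k : ℕ) (μ ν : Fin 4) (z : Fin 4 → ℤ) (i : ℕ), i < k + 1 → ∀ t d : ℝ, 0 < d →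
      t - d ∈ Ioc (0 : ℝ) γ → t + d ∈ Ioc (0 : ℝ) γ → ∀ᶠ K in atTop,
        |polWindow F K (k + 1) (crossTermFamily F (fun k v => fadingAmp ω k (fun j => v j ^ 2 / 2)) e k (histPrefix (Function.update g i (t + d)) k) K)
              (ContinuousLinearMap.id ℝ ℝ) (Module.Basis.singleton Unit ℝ) μ ν z -
            2 * polWindow F K (k + 1) (crossTermFamily F (fun k v => fadingAmp ω k (fun j => v j ^ 2 / 2)) e k (histPrefix (Function.update g i t) k) K)
              (ContinuousLinearMap.id ℝ ℝ) (Module.Basis.singleton Unit ℝ) μ ν z +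
            polWindow F K (k + 1) (crossTermFamily F (fun k v => fadingAmp ω k (fun j => v j ^ 2 / 2)) e k (histPrefix (Function.update g i (t - d)) k) K)
              (ContinuousLinearMap.id ℝ ℝ) (Module.Basis.singleton Unit ℝ) μ ν z| ≤
          ω * wt κ e * Real.exp (-(κ * l1 z)) * d ^ 2 := by
  refine ⟨polLimitsExist_cross F _ e γ, fun g _ k μ ν z i hi t d _ _ _ => ?_⟩
  filter_upwards [windowedSecondDiff_quadCross_eventually_eq F ω e g k μ ν z hi t d] with K hK
  rw [hK]
  refine (abs_crossKernel_le _ e μ ν z κ).trans ?_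
  have hpow : ω ^ (k + 1 - i) ≤ ω := by
    calc ω ^ (k + 1 - i) ≤ ω ^ 1 := pow_le_pow_of_le_one hω hω1 (by omega)
      _ = ω := pow_one ω
  rw [abs_of_nonneg (mul_nonneg (pow_nonneg hω _) (sq_nonneg d))]
  have hw := wt_nonneg κ e
  have he := Real.exp_nonneg (-(κ * l1 z))
  calc ω ^ (k + 1 - i) * d ^ 2 * wt κ e * Real.exp (-(κ * l1 z)) ≤ ω * d ^ 2 * wt κ e * Real.exp (-(κ * l1 z)) :=
      mul_le_mul_of_nonneg_right (mul_le_mul_of_nonneg_right (mul_le_mul_of_nonneg_right hpow (sq_nonneg d)) hw) he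
    _ = ω * wt κ e * Real.exp (-(κ * l1 z)) * d ^ 2 := by ring

end Windowed

end YMDAG.N22.KernelFading.Model

end
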